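import Literature.Analysis.FluidPDE.AncientSimilarityVariables
import Literature.Analysis.FluidPDE.RescaledEulerLeray
import Literature.Analysis.FluidPDE.PineauVicolOneSlice
import Literature.Analysis.FluidPDE.PineauVicolOneSliceProofs
import Literature.Analysis.FluidPDE.ClassicalSolutionRegion
import Literature.Analysis.FluidPDE.ClassicalSolutionRescale
import Literature.Analysis.FluidPDE.LocalTypeI
import Literature.Analysis.FluidPDE.LocalTypeICongr
import Literature.Analysis.FluidPDE.LocalTypeIScaling

/-!
# Crux `SymmetricScarExists` (stmt-NavierStokesRegularity-11718), line `logtime-bernoulli-certificate`: STUB 6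

The registered stub `stub_oneSliceCriterion` of the line's skeleton: Pineau–Vicol's one-slice
regularity theorem (arXiv:2607.09619, Thm. 1.9; tree: the named fact
`Literature.Analysis.FluidPDE.pineauVicol2026_oneSlice_regularity`, taken here as a HYPOTHESIS)
packaged in Leray's backward similarity variables `U(s,y) = √(−t) u(t,x)`, `y = x/√(−t)`,
`s = −log(−t)` (`u = ofLerayOrbit U`, `p = ofLerayOrbitPressure P`):

* the class `LB(C,K)` — `(U,P)` a classical solution of the backward Leray system on all `s ∈ ℝ`
  with the scale-invariant weighted bounds — gives, for the physical pair, a classical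
  Navier–Stokes solution on `(−∞,0) × ℝ³` (`isClassicalNSSolutionOn_Iio_ofLerayOrbit_iff`), hence on
  P–V's region `[−1,0) × B₁`; the Type I bound (1.15) (`hasTypeIDecay_iff_lerayOrbit`); and the
  annular pressure bound (1.16) with `C_p = max (4K) 1` (`(1+‖y‖)²|P| ≤ K` gives
  `|p| ≤ K/(√(−t)+‖x‖)² < 4K` on `½ < ‖x‖`);
* P–V's one-slice quantity is `√(−t̄)((−t̄)∂ₜu − ½u − ½(x·∇)u)(t̄,x) = ∂ₛU(s̄, x/√(−t̄))`,
  `s̄ = −log(−t̄)` (tree: `timeDeriv_lerayOrbit_neg_log`, P–V (1.18)), so smallness of `∂ₛU(s̄,·)`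
  on `B_R`, `R = e^{(s₀+1)/2}`, is (1.17) at `t̄ = −e^{−(s₀+1)} ∈ (−e^{−s₀}, 0)` — after the
  `s`-shift `U ↦ U(a + ·)`, `a = s̄ − (s₀+1)`, which preserves the class (the Leray system is
  autonomous) and is the parabolic rescaling `nsRescale e^{−a/2}` of the physical field
  (`lerayOrbit_nsRescale`), under which the singularity of the origin is invariant
  (`eLpNorm_top_nsZoom`);
* P–V's conclusion (`u` bounded on `B_r × (−r²,0)`) makes `(0,0)` NOT a backward singular point
  (`IsBackwardSingularPoint`: `ess sup_{Q_r} ‖u‖ = ∞` for all `r > 0`).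

Degenerate constants: `C ≤ 0` forces `U ≡ 0`, whose physical field `0` is not singular.

Helper file for the crux item (lands `--supports stmt-NavierStokesRegularity-11718`).
-/

noncomputable section

open Set Metric Function Filter MeasureTheory Topology
open scoped ENNReal

namespace Summit.NavierStokesRegularity.NavierStokesRegularity.Theorems.SymmetricScarExists.LogtimeBernoulli

open Literature.Analysis.FluidPDE

/-! ### The `s`-shift of a profile -/

/-- The one-sided time derivative within `univ` of the shifted profile `σ ↦ U(a + σ)` is the
shifted time derivative (translation invariance of `deriv`). [folklore] -/
theorem timeDerivWithin_univ_shift {F : Type*} [NormedAddCommGroup F] [NormedSpace ℝ F]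
    (U : ℝ → (EuclideanSpace ℝ (Fin 3)) → F) (a s : ℝ) (y : (EuclideanSpace ℝ (Fin 3))) :
    timeDerivWithin (univ : Set ℝ) (fun σ => U (a + σ)) s y =
      timeDerivWithin (univ : Set ℝ) U (a + s) y := by
  simp only [timeDerivWithin_apply, derivWithin_univ]
  exact deriv_comp_const_add (fun σ => U σ y) a s

/-- **The backward Leray system is autonomous**: the `s`-shift `(U(a + ·), P(a + ·))` of a
classical solution on all of `ℝ` is again a classical solution on all of `ℝ`. [folklore] -/
theorem isBackwardLeraySolutionOn_univ_shift {ν : ℝ} {U : ℝ → (EuclideanSpace ℝ (Fin 3)) → (EuclideanSpace ℝ (Fin 3))} {P : ℝ → (EuclideanSpace ℝ (Fin 3)) → ℝ}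
    (h : IsBackwardLeraySolutionOn (univ : Set ℝ) ν U P) (a : ℝ) :
    IsBackwardLeraySolutionOn (univ : Set ℝ) ν (fun s => U (a + s)) (fun s => P (a + s)) := by
  have hφ : ∀ {n : WithTop ℕ∞}, ContDiff ℝ n (fun z : ℝ × (EuclideanSpace ℝ (Fin 3)) => (a + z.1, z.2)) := fun {n} =>
    (contDiff_const.add contDiff_fst).prodMk contDiff_snd
  refine ⟨?_, ?_, fun t _ x => ?_, fun t _ => h.divFree (a + t) (mem_univ _)⟩
  · have h1 := h.smooth_velocity
    unfold IsSmoothSpaceTimeOn at h1 ⊢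
    rw [univ_prod_univ] at h1 ⊢
    have e : uncurry (fun s => U (a + s)) = uncurry U ∘ fun z : ℝ × (EuclideanSpace ℝ (Fin 3)) => (a + z.1, z.2) := by
      funext z; rfl
    rw [e]
    exact h1.comp hφ.contDiffOn fun _ _ => mem_univ _
  · have h1 := h.smooth_pressure
    unfold IsSmoothSpaceTimeOn at h1 ⊢
    rw [univ_prod_univ] at h1 ⊢
    have e : uncurry (fun s => P (a + s)) = uncurry P ∘ fun z : ℝ × (EuclideanSpace ℝ (Fin 3)) => (a + z.1, z.2) := by
      funext z; rfl
    rw [e]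
    exact h1.comp hφ.contDiffOn fun _ _ => mem_univ _
  · rw [timeDerivWithin_univ_shift]
    exact h.momentum (a + t) (mem_univ _) x

/-- **The `s`-shift is the parabolic rescaling of the physical field**: for `t < 0`,
`nsRescale e^{−a/2} (ofLerayOrbit U) t = ofLerayOrbit (U(a + ·)) t` (from `lerayOrbit_nsRescale`:
the Navier–Stokes scaling by `c` is the time shift `s ↦ s − 2 log c` of the profile). [folklore] -/
theorem nsRescale_ofLerayOrbit_slice (U : ℝ → (EuclideanSpace ℝ (Fin 3)) → (EuclideanSpace ℝ (Fin 3))) (a : ℝ) {t : ℝ} (ht : t < 0) :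
    nsRescale (Real.exp (-a / 2)) (ofLerayOrbit U) t = ofLerayOrbit (fun s => U (a + s)) t := by
  have hc : 0 < Real.exp (-a / 2) := Real.exp_pos _
  have key : lerayOrbit (nsRescale (Real.exp (-a / 2)) (ofLerayOrbit U)) =
      lerayOrbit (ofLerayOrbit (fun s => U (a + s))) := by
    funext s y
    rw [lerayOrbit_nsRescale hc, lerayOrbit_ofLerayOrbit_eq, lerayOrbit_ofLerayOrbit_eq, Real.log_exp]
    show U (s - 2 * (-a / 2)) y = U (a + s) y
    rw [show s - 2 * (-a / 2) = a + s by ring]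
  exact (lerayOrbit_eq_iff.1 key) t ht

/-! ### Backward singular points under scaling and under the shift -/

/-- **Scaling covariance of backward singular points at the origin**: if `(0,0)` is a backward
singular point of `u`, it is one of the parabolic rescaling `nsRescale c u`, `c > 0`
(`‖u_c‖_{L^∞(Q_r)} = c‖u‖_{L^∞(Q_{cr})}`, tree `eLpNorm_top_nsZoom`). [folklore] -/
theorem isBackwardSingularPoint_nsRescale {c : ℝ} (hc : 0 < c) {u : ℝ → (EuclideanSpace ℝ (Fin 3)) → (EuclideanSpace ℝ (Fin 3))}
    (h : IsBackwardSingularPoint u 0) : IsBackwardSingularPoint (nsRescale c u) 0 := by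
  intro r hr
  have e : nsRescale c u = c • stPull (c ^ 2) c 0 (0 : (EuclideanSpace ℝ (Fin 3))) u := by
    funext t x
    simp [stPull_apply, nsRescale_apply]
  have h0 : stAffine (c ^ 2) c 0 (0 : (EuclideanSpace ℝ (Fin 3))) (0 : ℝ × (EuclideanSpace ℝ (Fin 3))) = 0 :=
    Prod.ext (by simp [stAffine]) (by simp [stAffine])
  have key := eLpNorm_top_nsZoom hc 0 (0 : (EuclideanSpace ℝ (Fin 3))) r (0 : ℝ × (EuclideanSpace ℝ (Fin 3))) u
  rw [h0, h (c * r) (mul_pos hc hr), ENNReal.mul_top (ENNReal.ofReal_pos.2 hc).ne'] at key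
  rw [e]
  exact key

/-- A pointwise bound `‖u‖ ≤ M` on `B_r × (−r², 0)` (P–V's footnote 12: "`(0,0)` is a regular
point") makes `(0,0)` NOT a backward singular point: `ess sup_{Q_r(0,0)} ‖u‖ ≤ M < ∞`. [folklore] -/
theorem not_isBackwardSingularPoint_of_bound {u : ℝ → (EuclideanSpace ℝ (Fin 3)) → (EuclideanSpace ℝ (Fin 3))} {r M : ℝ} (hr : 0 < r)
    (h : ∀ t : ℝ, -r ^ 2 < t → t < 0 → ∀ x ∈ ball (0 : (EuclideanSpace ℝ (Fin 3))) r, ‖u t x‖ ≤ M) :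
    ¬ IsBackwardSingularPoint u 0 := by
  intro hs
  have hbound : ∀ z ∈ parabolicCylinder r (0 : ℝ × (EuclideanSpace ℝ (Fin 3))), ‖uncurry u z‖ ≤ M := by
    rintro ⟨t, x⟩ hz
    rw [mem_parabolicCylinder] at hz
    obtain ⟨⟨ht1, ht2⟩, hdist⟩ := hz
    exact h t (by simpa using ht1) (by simpa using ht2) x (by simpa using hdist)
  have hlt : eLpNorm (uncurry u) ∞ (volume.restrict (parabolicCylinder r (0 : ℝ × (EuclideanSpace ℝ (Fin 3))))) < ⊤ := by
    rw [eLpNorm_exponent_top]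
    exact eLpNormEssSup_lt_top_of_ae_bound
      (ae_restrict_of_forall_mem (isOpen_parabolicCylinder r _).measurableSet hbound)
  exact hlt.ne (hs r hr)

/-- **The `s`-shift preserves the singularity of the origin**: if `(0,0)` is backward singular for
`ofLerayOrbit U` then also for `ofLerayOrbit (U(a + ·)) = nsRescale e^{−a/2} (ofLerayOrbit U)`
(equality on the past, which contains every backward cylinder at the origin). [folklore] -/
theorem isBackwardSingularPoint_ofLerayOrbit_shift (U : ℝ → (EuclideanSpace ℝ (Fin 3)) → (EuclideanSpace ℝ (Fin 3))) (a : ℝ)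
    (h : IsBackwardSingularPoint (ofLerayOrbit U) 0) :
    IsBackwardSingularPoint (ofLerayOrbit (fun s => U (a + s))) 0 := by
  have h1 := isBackwardSingularPoint_nsRescale (Real.exp_pos (-a / 2)) h
  refine h1.congr_ae (S := Iio (0 : ℝ) ×ˢ (univ : Set (EuclideanSpace ℝ (Fin 3)))) (fun r _ w hw => ?_) ?_
  · rw [mem_parabolicCylinder] at hw
    exact ⟨by simpa using hw.1.2, mem_univ _⟩
  · refine ae_restrict_of_forall_mem (measurableSet_Iio.prod MeasurableSet.univ) ?_
    rintro ⟨t, x⟩ ⟨ht, -⟩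
    simp only [uncurry_apply_pair]
    rw [nsRescale_ofLerayOrbit_slice U a ht]

/-! ### The hypotheses of Theorem 1.9 for the physical field of a profile -/

/-- A classical Navier–Stokes solution on the whole past `(−∞, 0) × ℝ³` restricts to a classical
solution on P–V's region `[−1, 0) × B₁` (time sections `[−1,0)`, sets of unique
differentiability). [folklore] -/
theorem isClassicalNSSolutionOnRegion_pineauVicol_of_Iio {ν : ℝ} {f u : ℝ → (EuclideanSpace ℝ (Fin 3)) → (EuclideanSpace ℝ (Fin 3))}
    {p : ℝ → (EuclideanSpace ℝ (Fin 3)) → ℝ} (h : IsClassicalNSSolutionOn (Iio (0 : ℝ)) ν f u p) :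
    IsClassicalNSSolutionOnRegion (Ico (-1 : ℝ) 0 ×ˢ ball (0 : (EuclideanSpace ℝ (Fin 3))) 1) ν f u p := by
  have h1 : IsClassicalNSSolutionOn (Ico (-1 : ℝ) 0) ν f u p :=
    h.mono Ico_subset_Iio_self (uniqueDiffOn_Ico _ _)
  refine h1.onRegion.mono (prod_mono Subset.rfl (subset_univ _)) ?_
  intro t x htx
  rw [timeSection_prod _ htx.2]
  exact uniqueDiffOn_Ico (-1 : ℝ) 0 t htx.1

/-- **(1.15) from the profile bound**: `(1 + ‖y‖)‖U(s,y)‖ ≤ C` for all `s, y` gives the Type I bound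
`‖u(t,x)‖ ≤ C/(√(−t) + ‖x‖)` for `u = ofLerayOrbit U` (tree `hasTypeIDecay_iff_lerayOrbit`). [folklore] -/
theorem typeI_of_profile_bound {U : ℝ → (EuclideanSpace ℝ (Fin 3)) → (EuclideanSpace ℝ (Fin 3))} {C : ℝ}
    (h : ∀ (s : ℝ) (y : (EuclideanSpace ℝ (Fin 3))), (1 + ‖y‖) * ‖U s y‖ ≤ C) :
    ∀ t ∈ Ico (-1 : ℝ) 0, ∀ x ∈ ball (0 : (EuclideanSpace ℝ (Fin 3))) 1,
      ‖ofLerayOrbit U t x‖ ≤ C / (Real.sqrt (-t) + ‖x‖) := by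
  have hd : HasTypeIDecay C (ofLerayOrbit U) :=
    hasTypeIDecay_iff_lerayOrbit.2 fun s y => by rw [lerayOrbit_ofLerayOrbit]; exact h s y
  intro t ht x _
  rw [add_comm]
  exact hd t ht.2 x

/-- **(1.16) from the profile bound**: `(1 + ‖y‖)²|P(s,y)| ≤ K` gives
`|p(t,x)| ≤ 4(−t)(1 + ‖y‖)²|p(t,x)| = 4(1 + ‖y‖)²|P(s,y)| ≤ 4K ≤ max (4K) 1` on `½ < ‖x‖`, `t < 0`,
for `p = ofLerayOrbitPressure P` (`p = (−t)⁻¹ P`, `‖x‖ = √(−t)‖y‖`, so `(−t)‖y‖² = ‖x‖² > ¼`). [folklore] -/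
theorem pressure_annulus_of_profile_bound {P : ℝ → (EuclideanSpace ℝ (Fin 3)) → ℝ} {K : ℝ}
    (h : ∀ (s : ℝ) (y : (EuclideanSpace ℝ (Fin 3))), (1 + ‖y‖) ^ 2 * |P s y| ≤ K) :
    ∀ t ∈ Ico (-1 : ℝ) 0, ∀ x : (EuclideanSpace ℝ (Fin 3)), 1 / 2 < ‖x‖ → ‖x‖ < 3 / 4 →
      |ofLerayOrbitPressure P t x| ≤ max (4 * K) 1 := by
  intro t ht x hx1 _
  have ht0 : 0 < -t := by linarith [ht.2]
  have hsq : 0 < Real.sqrt (-t) := Real.sqrt_pos.2 ht0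
  set y : (EuclideanSpace ℝ (Fin 3)) := (Real.sqrt (-t))⁻¹ • x with hy
  have hxy : ‖x‖ = Real.sqrt (-t) * ‖y‖ := by
    rw [hy, norm_smul, norm_inv, Real.norm_of_nonneg hsq.le, ← mul_assoc, mul_inv_cancel₀ hsq.ne',
      one_mul]
  have hx2 : ‖x‖ ^ 2 = (-t) * ‖y‖ ^ 2 := by rw [hxy, mul_pow, Real.sq_sqrt ht0.le]
  have hP := h (-Real.log (-t)) y
  have habs : 0 ≤ |P (-Real.log (-t)) y| := abs_nonneg _
  have h14 : 1 / 4 < (-t) * ‖y‖ ^ 2 := by nlinarith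
  have hyy : (-t) * ‖y‖ ^ 2 ≤ (-t) * (1 + ‖y‖) ^ 2 := by
    have : ‖y‖ ^ 2 ≤ (1 + ‖y‖) ^ 2 := by nlinarith [norm_nonneg y]
    exact mul_le_mul_of_nonneg_left this ht0.le
  rw [ofLerayOrbitPressure_apply, abs_mul, abs_inv, abs_of_pos ht0]
  refine le_trans ?_ (le_max_left _ _)
  rw [inv_mul_le_iff₀ ht0]
  calc |P (-Real.log (-t)) y| = 4 * (1 / 4) * |P (-Real.log (-t)) y| := by ring
    _ ≤ 4 * ((-t) * (1 + ‖y‖) ^ 2) * |P (-Real.log (-t)) y| := by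
        gcongr
        exact (h14.le.trans hyy)
    _ = (-t) * (4 * ((1 + ‖y‖) ^ 2 * |P (-Real.log (-t)) y|)) := by ring
    _ ≤ (-t) * (4 * K) := by gcongr

/-- **(1.17) is the smallness of `∂ₛU` on one slice** (P–V (1.18)–(1.19)): for the physical field
`u = ofLerayOrbit U` of a profile solving the backward Leray system on all of `ℝ`, at every
`−1 < t̄ < 0` and `‖x‖ < 1`,
`√(−t̄)((−t̄)∂ₜu − ½u − ½Du[x])(t̄,x) = ∂ₛU(−log(−t̄), x/√(−t̄))` with P–V's `timeDerivOn` on the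
region `[−1,0) × B₁` (the genuine `∂ₜ` at interior times). [folklore] -/
theorem oneSlice_of_profile {U : ℝ → (EuclideanSpace ℝ (Fin 3)) → (EuclideanSpace ℝ (Fin 3))} {P : ℝ → (EuclideanSpace ℝ (Fin 3)) → ℝ}
    (hNS : IsClassicalNSSolutionOn (Iio (0 : ℝ)) 1 0 (ofLerayOrbit U) (ofLerayOrbitPressure P))
    {tbar : ℝ} (ht1 : -1 < tbar) (ht0 : tbar < 0) {x : (EuclideanSpace ℝ (Fin 3))} (hx : x ∈ ball (0 : (EuclideanSpace ℝ (Fin 3))) 1) :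
    Real.sqrt (-tbar) •
        ((-tbar) • timeDerivOn (Ico (-1 : ℝ) 0 ×ˢ ball (0 : (EuclideanSpace ℝ (Fin 3))) 1) (ofLerayOrbit U) tbar x
          - (1 / 2 : ℝ) • ofLerayOrbit U tbar x - (1 / 2 : ℝ) • fderiv ℝ (ofLerayOrbit U tbar) x x) =
      timeDerivWithin (univ : Set ℝ) U (-Real.log (-tbar)) ((Real.sqrt (-tbar))⁻¹ • x) := by
  have hdiff : DifferentiableAt ℝ (uncurry (ofLerayOrbit U)) (tbar, x) :=
    (hNS.smooth_velocity.contDiffAt isOpen_Iio ht0 x).differentiableAt (by simp)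
  rw [timeDerivOn_pineauVicol_region _ ht1 ht0 hx, ← timeDeriv_lerayOrbit_neg_log ht0 hdiff,
    lerayOrbit_ofLerayOrbit_eq, timeDeriv_apply, timeDerivWithin_apply, derivWithin_univ]

/-! ### The stub -/

/-- **STUB 6 of line `logtime-bernoulli-certificate`: Pineau–Vicol's one-slice criterion in Leray
variables.** Assuming the named fact `pineauVicol2026_oneSlice_regularity` (P–V 2026, Thm. 1.9):
for every `C` there is `δ > 0` and for every `K` a radius `R > 0` such that an eternal classical
solution `(U, P)` of the backward Leray system in the weighted class `LB(C, K)` which, on ONE slice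
`s̄`, has `‖∂ₛU(s̄, y)‖ ≤ δ` for `‖y‖ < R`, has a physical field `ofLerayOrbit U` for which `(0,0)`
is NOT a backward singular point. Proof: `δ = δ₀(C)`, `R = e^{(s₀(C, max(4K,1)) + 1)/2}`; shift
`s` by `a = s̄ − (s₀+1)` (autonomy; = parabolic rescaling, preserving the singularity of the
origin), pass to physical variables (classical NS on `[−1,0) × B₁`, (1.15), (1.16)), read the
slice hypothesis as (1.17) at `t̄ = −e^{−(s₀+1)}`, and conclude from the boundedness of `u` near
`(0,0)`; `C ≤ 0` forces `U ≡ 0`. [cite: PineauVicol2026, Theorem 1.9 (arXiv:2607.09619 p. 8)] -/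
theorem stub_oneSliceCriterion :
    Literature.Analysis.FluidPDE.pineauVicol2026_oneSlice_regularity → ∀ C : ℝ, ∃ δ : ℝ, 0 < δ ∧ ∀ K : ℝ, ∃ R : ℝ, 0 < R ∧ ∀ (U : ℝ → EuclideanSpace ℝ (Fin 3) → EuclideanSpace ℝ (Fin 3)) (P : ℝ → EuclideanSpace ℝ (Fin 3) → ℝ), (Literature.Analysis.FluidPDE.IsBackwardLeraySolutionOn (Set.univ : Set ℝ) 1 U P ∧ ∀ (s : ℝ) (y : EuclideanSpace ℝ (Fin 3)), (1 + ‖y‖) * ‖U s y‖ ≤ C ∧ (1 + ‖y‖) ^ 2 * ‖fderiv ℝ (U s) y‖ ≤ K ∧ (1 + ‖y‖) ^ 3 * ‖iteratedFDeriv ℝ 2 (U s) y‖ ≤ K ∧ (1 + ‖y‖) ^ 2 * |P s y| ≤ K ∧ (1 + ‖y‖) ^ 3 * ‖gradient (P s) y‖ ≤ K ∧ (1 + ‖y‖) * ‖Literature.Analysis.FluidPDE.timeDerivWithin (Set.univ : Set ℝ) U s y‖ ≤ K ∧ (1 + ‖y‖) ^ 2 * ‖fderiv ℝ (fun z => Literature.Analysis.FluidPDE.timeDerivWithin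 (Set.univ : Set ℝ) U s z) y‖ ≤ K ∧ (1 + ‖y‖) ^ 3 * ‖Literature.Analysis.FluidPDE.timeDerivWithin (Set.univ : Set ℝ) U s y + (1 / 2 : ℝ) • U s y + (1 / 2 : ℝ) • fderiv ℝ (U s) y y‖ ≤ K) → (∃ sbar : ℝ, ∀ y : EuclideanSpace ℝ (Fin 3), ‖y‖ < R → ‖Literature.Analysis.FluidPDE.timeDerivWithin (Set.univ : Set ℝ) U sbar y‖ ≤ δ) → ¬ Literature.Analysis.FluidPDE.IsBackwardSingularPoint (Literature.Analysis.FluidPDE.ofLerayOrbit U) 0 := by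
  intro hPV C
  by_cases hC : 0 < C
  · obtain ⟨δ₀, hδ₀, -, H⟩ := hPV C hC
    refine ⟨δ₀, hδ₀, fun K => ?_⟩
    have hCp : 0 < max (4 * K) 1 := lt_of_lt_of_le one_pos (le_max_right _ _)
    obtain ⟨s₀, hs₀, H'⟩ := H (max (4 * K) 1) hCp
    refine ⟨Real.exp ((s₀ + 1) / 2), Real.exp_pos _, ?_⟩
    rintro U P ⟨hsol, hLB⟩ ⟨sbar, hslice⟩ hsing
    -- the `s`-shift bringing the slice `s̄` to `s₀ + 1`
    obtain ⟨a, ha⟩ : ∃ a : ℝ, a + (s₀ + 1) = sbar := ⟨sbar - (s₀ + 1), by ring⟩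
    have hsol' := isBackwardLeraySolutionOn_univ_shift hsol a
    have hNS : IsClassicalNSSolutionOn (Iio (0 : ℝ)) 1 0 (ofLerayOrbit fun s => U (a + s))
        (ofLerayOrbitPressure fun s => P (a + s)) :=
      isClassicalNSSolutionOn_Iio_ofLerayOrbit_iff.2 hsol'
    have hreg := isClassicalNSSolutionOnRegion_pineauVicol_of_Iio hNS
    have hI := typeI_of_profile_bound (U := fun s => U (a + s)) fun s y => (hLB (a + s) y).1
    have hPb := pressure_annulus_of_profile_bound (P := fun s => P (a + s))
      fun s y => (hLB (a + s) y).2.2.2.1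
    -- the slice time `t̄ = −e^{−(s₀+1)}`
    have ht0 : -Real.exp (-(s₀ + 1)) < 0 := neg_exp_neg_lt_zero _
    have ht1 : -1 < -Real.exp (-(s₀ + 1)) := by
      rw [neg_lt_neg_iff]
      exact Real.exp_lt_one_iff.2 (by linarith)
    have htb : -Real.exp (-s₀) < -Real.exp (-(s₀ + 1)) :=
      neg_lt_neg (Real.exp_lt_exp.2 (by linarith))
    have hlog : -Real.log (-(-Real.exp (-(s₀ + 1)))) = s₀ + 1 := by
      rw [neg_neg, Real.log_exp, neg_neg]
    have hsqrt : Real.sqrt (-(-Real.exp (-(s₀ + 1)))) = Real.exp (-(s₀ + 1) / 2) := by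
      rw [neg_neg, sqrt_exp_neg]
    have hslice' : ∀ x ∈ ball (0 : (EuclideanSpace ℝ (Fin 3))) 1,
        ‖Real.sqrt (-(-Real.exp (-(s₀ + 1)))) •
            ((-(-Real.exp (-(s₀ + 1)))) •
                timeDerivOn (Ico (-1 : ℝ) 0 ×ˢ ball (0 : (EuclideanSpace ℝ (Fin 3))) 1) (ofLerayOrbit fun s => U (a + s))
                  (-Real.exp (-(s₀ + 1))) x
              - (1 / 2 : ℝ) • ofLerayOrbit (fun s => U (a + s)) (-Real.exp (-(s₀ + 1))) x
              - (1 / 2 : ℝ) • fderiv ℝ (ofLerayOrbit (fun s => U (a + s)) (-Real.exp (-(s₀ + 1)))) x x)‖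
          ≤ δ₀ := by
      intro x hx
      rw [oneSlice_of_profile hNS ht1 ht0 hx, hlog, timeDerivWithin_univ_shift, ha]
      apply hslice
      rw [norm_smul, norm_inv, hsqrt, Real.norm_of_nonneg (Real.exp_pos _).le, ← Real.exp_neg,
        show -(-(s₀ + 1) / 2) = (s₀ + 1) / 2 by ring]
      have hx1 : ‖x‖ < 1 := mem_ball_zero_iff.1 hx
      calc Real.exp ((s₀ + 1) / 2) * ‖x‖ < Real.exp ((s₀ + 1) / 2) * 1 := by gcongr
        _ = Real.exp ((s₀ + 1) / 2) := mul_one _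
    obtain ⟨r, hr, M, hM⟩ := H' _ _ hreg hI hPb _ htb ht0 hslice'
    exact not_isBackwardSingularPoint_of_bound hr hM
      (isBackwardSingularPoint_ofLerayOrbit_shift U a hsing)
  · -- `C ≤ 0`: the profile vanishes identically, and so does its physical field
    push Not at hC
    refine ⟨1, one_pos, fun K => ⟨1, one_pos, ?_⟩⟩
    rintro U P ⟨-, hLB⟩ - hsing
    have hU0 : ∀ (s : ℝ) (y : (EuclideanSpace ℝ (Fin 3))), U s y = 0 := fun s y => by
      have h1 := (hLB s y).1
      have h3 : ‖U s y‖ ≤ 0 := by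
        nlinarith [norm_nonneg (U s y), norm_nonneg y, mul_nonneg (norm_nonneg y) (norm_nonneg (U s y))]
      exact norm_le_zero_iff.1 h3
    refine not_isBackwardSingularPoint_of_bound (M := 0) one_pos (fun t _ _ x _ => ?_) hsing
    rw [ofLerayOrbit_apply, hU0, smul_zero, norm_zero]

end Summit.NavierStokesRegularity.NavierStokesRegularity.Theorems.SymmetricScarExists.LogtimeBernoulli

end
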